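import Mathlib
import HarnessLib
import HarnessLib.Audit
import Summits.Schanuel.Statement
import HarnessLib.Audit.Status.Attr

/-!
Route: ToricSector

DORMANT since 2026-08-23T13:36:23Z (reconciler: no traction for 6.1 d (last activity item-evidence-added at 2026-08-17T10:59:37Z); parked, not closed — `ledger route dormant route-Schanuel-ToricSector --off` to reactivate) — unstaffed, not closed; items shared with open routes are served there. `ledger route dormant <id> --off` reactivates.

# Route ToricSector — Schanuel = toric sector (binomial relation ideals log-linearise; level 2 =
tower atom ∧ self-log atom, by census) + "a first-failure counterexample is toric"

Gen-2 (summit-deciding) realisation of card Schanuel/Schanuel/toric-sparse-schanuel; gen-1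
route-Schanuel-ToricSparse was retired
not-a-thesis because its assembly stopped at the level-2 sector. For ℚ-linearly independent x ∈ ℂⁿ
all 2n coordinates of
p = (x, eˣ) are non-zero, so p ∈ 𝔾ₘ^{2n}(ℂ); call x TORIC-BAD if p satisfies n + 1 ℤ-independent
algebraic Laurent-monomial
relations p^v ∈ ℚ̄ (equivalently p lies on an algebraic translate g·T of a subtorus of dimension ≤ n
− 1; prime binomial ideals are
exactly the ideals of such translates, EisenbudSturmfels1996). It suffices to show X = X₁ ∧ X₂ with
X₁ = ToricSchanuel (THE SECTOR): no ℚ-linearly independent x is toric-bad, at every level n — level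
1 is Hermite–Lindemann, level 2 is
decided EXACTLY by two atoms (ToricCensusTwo: TowerAtom ∧ SelfLogMonomialAtom, provable now), level
4 contains the four exponentials
conjecture; and X₂ = FirstFailureIsToric (THE COMPLEMENT, in its weakest closing form): a
first-failure counterexample to Schanuel
(Schanuel holds at every lower rank r < n — stated inline, verbatim `SchanuelRank r` by `Iff.rfl`; x
independent with trdeg ℚ(x, eˣ) < n) IS toric-bad. X₁ is what the card's
log-linearisation engine attacks; X₂ is filed openly as "Schanuel off the toric sector" so that the
route decides the summit and the
ledger records exactly what the sector leaves (no engine is claimed for X₂; SC ⟹ X₂ vacuously and SC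
⟹ X₁, support ToricSplitExact).
Lean: `(∀ (n : ℕ) (x : Fin n → ℂ), LinearIndependent ℚ x → ∀ v : Fin (n + 1) → (Fin n ⊕ Fin n → ℤ),
LinearIndependent ℤ v → ∃ k, Transcendental ℚ (∏ i, Sum.elim x (Complex.exp ∘ x) i ^ (v k i))) ∧ (∀
(n : ℕ), (∀ r < n, ∀ (z : Fin r → ℂ), LinearIndependent ℚ z → (r : Cardinal) ≤ Algebra.trdeg ℚ
↥(IntermediateField.adjoin ℚ (Set.range z ∪ Set.range (Complex.exp ∘ z)))) → ∀ (x : Fin n → ℂ),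
LinearIndependent ℚ x → Algebra.trdeg ℚ ↥(IntermediateField.adjoin ℚ (Set.range x ∪ Set.range
(Complex.exp ∘ x))) < (n : Cardinal) → ∃ v : Fin (n + 1) → (Fin n ⊕ Fin n → ℤ), LinearIndependent ℤ
v ∧ ∀ k, IsAlgebraic ℚ (∏ i, Sum.elim x (Complex.exp ∘ x) i ^ (v k i)))`

## Assembly
Pure logic over the two cruxes X₁, X₂ (sorry-free `closes` in glue.lean / Sketch.lean, axioms
propext / Classical.choice /
Quot.sound): unfold `Schanuel` to ∀ n z, LinearIndependent ℚ z → n ≤ trdeg; strong induction on n;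
if trdeg < n then, the induction
hypothesis being verbatim the inlined rank-r hypothesis of FirstFailureIsToric (= `SchanuelRank r`)
for r < n, FirstFailureIsToric yields n + 1 ℤ-independent algebraic monomials and
ToricSchanuel a transcendental one among them — contradiction. The census, atoms and normal forms
are the internal structure of X₁
(level 2 decided exactly; higher levels not decomposed) and do not enter `closes`.

Rationale: WHY THIS LINE. Mechanism (card toric-sparse-schanuel; menu "reformulate" + "regime decomposition"):
grade putative Schanuel counterexamples by the
number of MONOMIALS in their relations — a parameter none of the 15 open routes uses (they grade by
depth, ℚ̄-rank, degree-1 shadow,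
value patterns of logarithms, definability) — and take the 2-monomial (toric) sector, the one sector
where elimination is exact:
with 𝓛 = {z : e^z ∈ ℚ̄} (a ℚ-subspace containing 2πiℤ, so branches never matter) the condition p^v ∈
ℚ̄ reads a·Log x + b·x ∈ 𝓛,
so "x toric-bad" ⟺ dim_ℚ(ℚ⟨x, Log x⟩ + 𝓛)/𝓛 ≤ n − 1 ⟺ x consists of n ℚ-independent algebraic
Laurent monomials cᵢw^{mᵢ} of some
w ∈ (ℂˣ)^{n−1} all lying in ℚ⟨Log w⟩ + 𝓛 (MonomialNormalForm, Smith normal form of the exponent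
lattice): Schanuel's toric sector
is Baker's problem for the module spanned by a point TOGETHER WITH ITS OWN LOGARITHM, and at n = 2
sorting (m₁, m₂) ∈ ℤ² closes
every branch by Hermite–Lindemann (tree theorem
`Literature.NumberTheory.Transcendental.transcendental_exp_holds`) except exactly two
atom shapes — TowerAtom (one mᵢ = 0: c·e^β − qβ ∉ 𝓛, "second-storey Hermite–Lindemann", contains
e^e, eπ, π/e ∉ ℚ̄) and the
self-logarithmic monomial atom Ω (m₁m₂ ≠ 0, whose pure-log face TwoLogMonomialAtom ℓ₁^pℓ₂^q ∉ ℚ̄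
contains e^{π²}, 2^{log 2} ∉ ℚ̄ of
Waldschmidt2005Periodes Ex. 26 and whose face p + q = 0 is KNOWN by Gelfond1934 / BakerTNT1975 Thm
2.1, tree `baker_holds`).
Imported: toric/binomial commutative algebra (EisenbudSturmfels1996) for the dictionary; the
unlikely-intersection grammar of
Zilber2002 / KirbyZilber2014 / Pila2022 §18 (SC ⟺ "a ℚ̄-variety V ⊂ ℂⁿ × (ℂˣ)ⁿ with dim V < n meets
the graph of exp only at
ℚ-dependent z", p. 124; there cosets of subtori live on the multiplicative side only — here the
additive coordinates are ALSO treated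
torically); linear forms in logarithms (BakerTNT1975) as the engine closing the known faces; the
first-failure / strong-induction
format of the complement from Kirby2010EAEF Prop. 7.2 (essential counterexamples, tree
`schanuelConjecture_iff_ecl_empty_holds`) and
route-Schanuel-RigidCore. Every tree fact used (HL, LW, GS, Baker, six exponentials) is PROVED;
there is NO import beyond the Statement (cone repair 2026-08-15: the rank-r Schanuel hypothesis of
FirstFailureIsToric, formerly the definition `SchanuelRank r` of Roy2001 Conj. 1, is written inline
— the same term by `Iff.rfl`). What it does that prior routes do not: LogPatterns / AdelicLogSector
/ BenfordTowers
split SC along a SUBFIELD (ℚ(𝓛), ℚ(log p)); RoyCriterion / AlgIndepMethod attack 𝓛 itself;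
CoprimeExpPolynomials grades by
ℚ̄-rank — the toric split is by the SHAPE of the relation ideal, orthogonal to all of them
(binomials have any degree and rank), its
sector census is a theorem rather than a heuristic, and its complement is stated in the sharpest
closing form (first failure, same x)
so that a prover of X₂ may assume Schanuel below rank n for free. Honest limit: toward PROVING
Schanuel the route adds an exact map of
where e^e, eπ, e^{π²}, 2^{log 2}, four exponentials sit and five provable-now theorems, not leverage
on X₂.

RANKED CRUXES. #2 ToricCensusTwo (crux) — TORIC CENSUS, n = 2 (card T2, sharpened to an equivalence;
both sides INLINED because the gate renders rank 2 first — definitionally `level-2 ToricSchanuel ↔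
(TowerAtom ∧ SelfLogMonomialAtom)`): for ℚ-independent pairs, "among any three ℤ-independent Laurent
monomials in (x₁, x₂, e^{x₁}, e^{x₂}) one is transcendental" holds iff both atoms hold. Proof plan
(provable now): MonomialNormalFormTwo, then sort (m₁, m₂): (0, 0) contradicts Hermite–Lindemann (𝓛 ∩
ℚ̄ = {0}); exactly one mᵢ = 0 rescales to a TowerAtom failure and back (w = e^{(β−ℓ)/r}, x = (β,
c·e^{β′}); conversely x = (β, c·e^β) carries X₁, X₂Y₁⁻¹, Y₂ᵗY₁⁻ˢ ∈ ℚ̄); m₁m₂ ≠ 0 is verbatim Ω.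
STAFF IT FIRST: it is the item saying the sector has exactly these two atoms and no third. [deps:
TowerAtom, SelfLogMonomialAtom, MonomialNormalFormTwo] [difficulty: M] (why it might fail: a
configuration lost in the WLOG rescalings (roots of unity in cᵢ, t ↦ t/d, saturation of Λ vs Λ⊗ℚ,
the branch of Log w) would be a third atom shape and refute the ↔ as stated (then restate with that
atom added).) [EisenbudSturmfels1996, Lindemann1882, BakerTNT1975, Zilber2002, Pila2022]
#3 SelfLogMonomialAtom (crux) — SELF-LOGARITHMIC MONOMIAL ATOM Ω (card atoms β, γ and the
two-variable branch, unified): for w ≠ 0, algebraic β₁, β₂ ≠ 0, non-zero integers m₁, m₂ and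
rationals r₁, r₂ with β₁w^{m₁}, β₂w^{m₂} ℚ-linearly independent, NOT both βᵢw^{mᵢ} − rᵢ·Log w are
logarithms of algebraic numbers (equivalently e^{βᵢw^{mᵢ}} ∈ ℚ̄·w^{rᵢ} cannot hold twice). Faces: r
= (0,0) = TwoLogMonomialAtom (support; its sub-face p + q = 0 known, LogRatioKnown); one rᵢ = 0:
Lambert/Ω-type e^{βwᵐ} ∈ ℚ̄·wʳ for w a radical of a logarithm; r₁r₂ ≠ 0, m₁ ≠ m₂: w a root of the
trinomial β₁W^{m₁}/r₁ − β₂W^{m₂}/r₂ = ℓ ∈ 𝓛 with e^{β₁w^{m₁}/r₁} ∈ ℚ̄·w. A consequence of Schanuel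
(x = (β₁w^{m₁}, β₂w^{m₂}) would be toric-bad). [difficulty: open-problem] (why it might fail: its r
= 0 face is 2-log algebraic independence (e^{π²}, 2^{log 2}, π·log 2 ∉ ℚ̄): beyond Baker and
provably beyond the linear subgroup method (Roy1995 Thm 3.4, tree LinearSubgroupMethodLimit); for r
≠ 0 no tool sees Log w of a transcendental w.) [Waldschmidt2005Periodes, Waldschmidt2005, Roy1995,
Pila2022, DaquinoFornasieroTerzo2017, MarquesSondow2010]
#4 TowerAtom (crux) — TOWER ATOM (second-storey Hermite–Lindemann; the exact toric form of card atom
α): for algebraic β ≠ 0, algebraic c ≠ 0 and rational q, c·e^β − qβ is not the logarithm of an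
algebraic number, i.e. e^{c·e^β} ∉ ℚ̄·e^{qβ}. Instances: e^e ∉ ℚ̄ (β = c = 1, q = 0), e^e ∉ ℚ̄·e^ℚ,
eπ ∉ ℚ̄ and π/e ∉ ℚ̄ (β = ∓1, q = 0, iπ ∈ 𝓛), e ∉ ℚ + 𝓛. A consequence of Schanuel (x = (β, c·e^β):
trdeg ℚ(e^β, e^{ce^β}) = 2). [difficulty: open-problem] (why it might fail: contains e^e ∉ ℚ̄ and eπ
∉ ℚ̄ (open; Rivoal2024 §4 p. 204, BakerTNT1975 Ch. 12); e^{c·e^z} is not an E-function, so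
Siegel–Shidlovskii is blind and no auxiliary function adapted to both storeys is known.)
[Rivoal2024, BakerTNT1975, Lindemann1882, Lang1966, Waldschmidt2004]
#5 ToricSchanuel (crux) — TORIC SCHANUEL, all levels (the SECTOR X₁; card "Toric-SC(n) for all n"):
for every n and every ℚ-linearly independent x ∈ ℂⁿ, among any n + 1 ℤ-linearly independent Laurent
monomials in (x₁,…,xₙ, e^{x₁},…,e^{xₙ}) at least one is transcendental — the point (x, eˣ) lies on
no algebraic translate of a subtorus of 𝔾ₘ^{2n} of dimension ≤ n − 1. Level 1 = Hermite–Lindemann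
(support LevelOneIsHermiteLindemann); level 2 ⟺ TowerAtom ∧ SelfLogMonomialAtom (ToricCensusTwo);
level 4 contains the four exponentials conjecture (x = (x₁y₁, x₁y₂, x₂y₁, x₂y₂) ∈ 𝓛⁴ carries X₁X₄ =
X₂X₃; a prover may attach `ToricSchanuel →
Literature.NumberTheory.Transcendental.FourExponentialsConjecture` with --supports). Schanuel ⟹ it
(support SchanuelImpliesToric). [difficulty: open-problem] (why it might fail: level 2 already
contains e^e, eπ, e^{π²}, 2^{log 2} ∉ ℚ̄ and level 4 the four exponentials conjecture; beyond n = 2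
the level census may not close into finitely many atom TYPES; false iff one binomial Schanuel
counterexample exists (which refutes SC itself).) [Lang1966, Pila2022, Waldschmidt2005,
Waldschmidt2005Periodes, EisenbudSturmfels1996, Zilber2002]
#6 FirstFailureIsToric (crux) — THE COMPLEMENT X₂ ("Schanuel off the toric sector", weakest closing
form): if Schanuel holds at every rank r < n (stated inline; = `SchanuelRank r` by `Iff.rfl`) and x
∈ ℂⁿ is ℚ-linearly independent with trdeg ℚ(x, eˣ) < n, then x is toric-bad — (x, eˣ) satisfies n +
1 ℤ-independent algebraic Laurent-monomial relations. Vacuous under Schanuel; at a first failure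
trdeg = n − 1 exactly and every coordinate pair (xᵢ, e^{xᵢ}) is algebraic over the others; trivially
true when trdeg = 0. Structural claim about minimal counterexamples, parallel to (and combinable
with) Kirby2010EAEF Prop. 7.2 (essential counterexamples lie in ecl(∅), tree
`schanuelConjecture_iff_ecl_empty_holds`) and route-Schanuel-RigidCore's MinimalCounterexampleInAcl.
Its functional analogue is TRUE and is Ax's theorem (a functional deficit comes from a ℚ-linear
dependence of exponents mod ℂ, i.e. a Y-monomial relation) — which is exactly why Ax gives nothing
here (barrier AxSchanuelFunctionalNotNumerical). [difficulty: open-problem] (why it might fail: it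
is most of Schanuel: at n = 2 it says P(e, π) = 0 forces an algebraic monomial eᵃπᵇiᶜ; no descent is
known (dividing out a relation y^b = γ lands on "ℓ ∈ 𝓛 algebraic over ℚ(x′, e^{x′})", i.e. e ⊥ π
again); no engine is claimed — SC ⟹ it vacuously.) [Kirby2010EAEF, Pila2022, Lang1966,
BaysKirby2018ANT, Ax1971]
#9 TwoLogMonomialAtom (support) — TWO-LOG MONOMIAL ATOM (rung = pure-log face r = 0 of Ω;
Waldschmidt's three-logarithm / four-exponentials family, monomial case; implied by
LogPatterns.LogSector = AlgIndepLogarithms, so a prover may attach `LogSector →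
TwoLogMonomialAtom`): for ℚ-linearly independent logarithms of algebraic numbers ℓ₁, ℓ₂ and integers
(p, q) ≠ (0, 0), ℓ₁^p·ℓ₂^q is transcendental. Contains e^{π²} ∉ ℚ̄ ((iπ)²·(π²)⁻¹ = −1), 2^{log 2} ∉
ℚ̄, (log 2)(log 3) ∉ ℚ̄, π·log 2 ∉ ℚ̄; the face p + q = 0 is KNOWN (LogRatioKnown). Open problem;
filed as support (a face of crux 3, reached through TwoLogIffPureSelfLog). [difficulty:
open-problem] [Waldschmidt2005Periodes, Waldschmidt2005, Pila2022, Roy1995, Roy1992, BakerTNT1975,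
Gelfond1934]
#9 MonomialNormalForm (support) — MONOMIAL NORMAL FORM, all n (card T1 = the log-linearisation
dictionary, multiplicative form; level n = k + 1): ToricSchanuel ⟺ for every w ∈ (ℂˣ)ᵏ, any k + 1
ℚ-linearly independent algebraic Laurent monomials cᵢ·w^{mᵢ} do not all lie in ℚ·Log w₁ + … + ℚ·Log
w_k + 𝓛 ("the algebraic monomials of w inside ℚ⟨Log w⟩ + 𝓛 span ≤ k dimensions"; k = 0 is
Hermite–Lindemann). ⇒: Log xᵢ = log cᵢ + Σ mᵢⱼ Log wⱼ mod 2πiℤ ⊂ 𝓛, so all of x, Log x lie in ℚ⟨Log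
w⟩ + 𝓛 and rank Λ_x = 2n − dim(ℚ⟨x, Log x⟩ + 𝓛)/𝓛 ≥ n + 1. ⇐: rank Λ_x ≥ n + 1 puts x, Log x in
span(t₁..t_k) + 𝓛; write Log xᵢ = Σ (mᵢⱼ/d)tⱼ + ℓᵢ, wⱼ = e^{tⱼ/d}, cᵢ = e^{ℓᵢ}. Pure algebra: 𝓛 is a
ℚ-subspace, x^a = e^{a·Log x} for a ∈ ℤ. [difficulty: provable-now] [EisenbudSturmfels1996,
Zilber2002, BakerTNT1975]
#9 MonomialNormalFormTwo (support) — MONOMIAL NORMAL FORM, n = 2 (the case the census uses; left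
side = level-2 ToricSchanuel inlined): for every w ≠ 0, two ℚ-linearly independent algebraic Laurent
monomials c₁w^{m₁}, c₂w^{m₂} (mᵢ ∈ ℤ, possibly 0) never both lie in ℚ·Log w + 𝓛. [difficulty:
provable-now] [EisenbudSturmfels1996, BakerTNT1975]
#9 LevelOneIsHermiteLindemann (support) — LEVEL 1 of the sector is Hermite–Lindemann (unit test of
the monomial dictionary, provable now from tree `transcendental_exp_holds`): for x ≠ 0, among any
two ℤ-independent monomials x^{a₁}e^{b₁x}, x^{a₂}e^{b₂x} one is transcendental (if both were
algebraic, x^{det} and e^{det·x} would be algebraic with det ≠ 0, so x ∈ ℚ̄ˣ and e^{det·x} ∈ ℚ̄,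
contradicting HL). [difficulty: provable-now] [Lindemann1882, BakerTNT1975]
#9 TwoLogIffPureSelfLog (support) — the two-log atom IS the pure-log face (r = 0) of Ω:
TwoLogMonomialAtom ⟺ for w ≠ 0 two ℚ-independent algebraic monomials β₁w^{m₁}, β₂w^{m₂} (mᵢ ≠ 0) are
not both in 𝓛. (⇒: ℓᵢ = βᵢw^{mᵢ} gives ℓ₁^{m₂}ℓ₂^{−m₁} ∈ ℚ̄. ⇐: for ℓ₁^pℓ₂^q = γ reduce to p, q
coprime, take a, b with bp − aq = 1, w = ℓ₁^aℓ₂^b; {(a,b),(p,q)} is a basis of ℤ², so ℓᵢ =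
w^{mᵢ}γ′^{sᵢ} with mᵢ = ±q, ±p ≠ 0; the case pq = 0 is Hermite–Lindemann directly.) [difficulty:
provable-now] [BakerTNT1975, Lindemann1882]
#9 LogRatioKnown (support) — the KNOWN face p + q = 0 of the two-log atom: for ℚ-independent ℓ₁, ℓ₂
∈ 𝓛 and p ≠ 0, (ℓ₁/ℓ₂)^p is transcendental (else ℓ₁ = bℓ₂ with b ∈ ℚ̄ ∖ ℚ, a vanishing ℚ̄-linear
form in two ℚ-independent logarithms, contradicting Baker, tree
`Literature.NumberTheory.Transcendental.baker_holds`; or Gelfond–Schneider,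
`gelfond_schneider_holds`). [difficulty: provable-now] [Gelfond1934, BakerTNT1975]
#9 SchanuelImpliesToric (support) — the sector lies below the summit: Schanuel ⟹ ToricSchanuel (n +
1 independent algebraic monomial values put p = (x, eˣ) on a ℚ̄-variety of dimension ≤ n − 1, so
trdeg ℚ(x, eˣ) ≤ n − 1; in Lean: complete the n + 1 exponent vectors by n − 1 coordinate monomials
to a ℚ-basis, every coordinate is algebraic over the field generated by those n − 1 values and ℚ̄,
`Algebra.trdeg` monotonicity / `IsTranscendenceBasis` cardinality). [difficulty: L] [Lang1966,
Pila2022]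
#9 ToricSplitExact (support) — the toric split is EXACT: Schanuel ⟺ ToricSchanuel ∧
FirstFailureIsToric (→: SchanuelImpliesToric and vacuity of the complement's hypothesis trdeg < n;
←: the deciding theorem `closes`, strong induction on n). Records that the route neither weakens nor
strengthens the summit. [difficulty: L] [Lang1966, Kirby2010EAEF]

TWO-LAYER PLAN. Foreseen glued splits (k ≤ 3, depth 1), filed only when something lands: (i)
SelfLogMonomialAtom ⇐ PureLogFace (= TwoLogMonomialAtom
via TwoLogIffPureSelfLog) → LambertFace (one rᵢ = 0: e^{βwᵐ} ∉ ℚ̄·wʳ for w a radical of a non-zero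
logarithm; the object of card
exp-log-diagonal-trajectory) → DoubleSelfLogFace (r₁r₂ ≠ 0) → SelfLogMonomialAtom; (ii) TowerAtom ⇐
TowerPure (q = 0: e^{c·e^β} ∉ ℚ̄,
the e^e family) → TowerMixed (q ≠ 0) → TowerAtom, above it the shared rung "1, λ, e^β are
ℚ̄-linearly independent (λ ∈ 𝓛 ∖ 0,
β ∈ ℚ̄ˣ)" to be filed ONCE together with card linear-schanuel-all-depths (it implies TowerAtom);
(iii) ToricSchanuel ⇐ LevelLeTwo
(= HL + ToricCensusTwo's right side) → LevelThreeFour (the four-exponentials-type configurations,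
via MonomialNormalForm at k = 2, 3;
the case tree over (m, r) modulo GL_k(ℤ) is a kit computation, card T6) → HigherLevels →
ToricSchanuel; (iv) ToricCensusTwo ⇐
MonomialNormalFormTwo → CaseSplit → ToricCensusTwo if a prover wants the normal form as a separate
landing. FirstFailureIsToric stays
undecomposed (no mechanism to split it honestly; its n ≤ 2 face "a counterexample pair is toric-bad"
is SC(2) reshaped).

KILL CRITERIA. A toric-bad ℚ-independent tuple (¬ToricSchanuel, e.g. a certified binomial relation
for (e, 1), (1, iπ) or (iπ, π²)) refutes
Schanuel outright — every route closes. ToricCensusTwo refuted by an explicit third configuration ⇒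
misstated: add the repaired
census (that atom adjoined) as a new item and re-certify `closes` (unchanged, it does not use the
census). TowerAtom or
SelfLogMonomialAtom refuted ⇒ ¬(level-2 ToricSchanuel) by the census ⇒ Schanuel refuted.
FirstFailureIsToric and ToricSchanuel are
consequences of Schanuel (ToricSplitExact), so a refutation of either IS a refutation of the summit;
conversely nothing short of
that can kill them — the route is retired `superseded`, not refuted, if a refuter shows the
monomial/bi-logarithmic normal form and
the level-2 census already in print (Zilber–Kirby exponential-closure literature, Waldschmidt2000
Ch. 1 exercises): then the supports
are `known` and TowerAtom / TwoLogMonomialAtom should be filed as Literature open statements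
instead. AlgIndepLogarithms proved
elsewhere moots TwoLogMonomialAtom and the r = 0 face only; Schanuel proved elsewhere moots
everything.

NOT DECOMPOSED YET. The three faces of Ω and the two of TowerAtom (Two-layer plan) — children,
later; quantitative versions (measures of simultaneous
approximation for (w, Log w) à la Waldschmidt2000 Ch. 15) that might close thin sub-faces of Ω (e.g.
m₁ = −m₂); the level census of
ToricSchanuel for n ≥ 3 (MonomialNormalForm gives the statement; the case tree is a kit computation,
card T6, not an item — log the
height bound reached, no silent caps); the functional face (bi-toric weak CIT from Ax1971, card T5)
— true but not load-bearing, and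
importing `ax_schanuel` would add cone for nothing; Eisenbud–Sturmfels itself (toric-badness is
stated directly by monomials, so no
binomial-ideal theory enters Lean); FirstFailureIsToric entirely (see Two-layer plan); the link
ToricSchanuel → FourExponentialsConjecture
(a `--supports` lemma for provers; not an item, to keep the route free of undeclared conjecture
leaves).

CHEAPEST FALSIFIER. (1) A grounder re-derives the n = 2 census from MonomialNormalFormTwo in an
hour: the only delicate branch is m₁m₂r₁r₂ ≠ 0 with
m₁ ≠ m₂ (it lands inside Ω verbatim, since Ω quantifies over all r ∈ ℚ²); any configuration escaping
Tower ∧ Ω kills ToricCensusTwo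
as stated (re-derived by hand this session: m = (0,0) dies by HL; one mᵢ = 0 ⟺ Tower failure both
ways; TwoLogIffPureSelfLog's ⇐
needs a unimodular basis change and HL for pq = 0). (2) Lookup of a bi-logarithmic / monomial normal
form in Zilber2002,
KirbyZilber2014, Waldschmidt2000: run this session — `lit search --hybrid` + `lit vsearch` (monomial
/ torus-translate phrasing) →
Pila2022 pp. 124–125 (SC ⟺ dim V < n form; subtori on the multiplicative side only), nothing
bi-toric; `lit galaxy search --star all`
(two queries) → Murty–Rath 2014, Steuding, Lang, two theses, no sparsity grading. (3) PSLQ at 60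
digits on e^e, eπ, e^{π²},
2^{log 2} against ℚ̄-multiples of small height (negative expected; a positive result refutes
Schanuel). (4) `lean check` of
Sketch.lean (this folder): all 14 items + `closes` elaborate, rc 0, 0 sorries.

NUMBERS. Items at open: 14 (5 cruxes, 8 supports, 1 assembly). Known: level 1 of ToricSchanuel =
Hermite–Lindemann; the face p + q = 0 of
TwoLogMonomialAtom (Gelfond–Schneider 1934 / Baker 1966); Baker: ℚ̄ˣ + ℚ̄·𝓛 is disjoint from 𝓛;
SchanuelRank 0 (tree
`schanuelRank_zero`) and SchanuelRank 1 (= HL) hold, so FirstFailureIsToric has content from n = 2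
on, where trdeg = 1 exactly.
Open flagship instances inside the sector: e^e, eπ, π/e (TowerAtom); e^{π²}, 2^{log 2}, π·log 2,
(log 2)(log 3) ∉ ℚ̄
(TwoLogMonomialAtom); four exponentials (level 4). Tree facts used, all PROVED:
transcendental_exp_holds, algebraicIndependent_exp_holds,
gelfond_schneider_holds, baker_holds, six_exponentials_holds; no definition imported (the rank-r
hypothesis of FirstFailureIsToric is `Literature.NumberTheory.Transcendental.SchanuelRank r` of
Roy2001 Conj. 1 written out, `Iff.rfl`; `Schanuel` is `∀ n, SchanuelRank n`; the route file imports
only `Summits.Schanuel.Statement`).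

DEFINITION REQUESTS. None. 𝓛 is written pointwise as `IsAlgebraic ℚ (Complex.exp l)` (as in tree
`baker`, `AlgIndepLogarithms`); toric-badness is written
by monomials `∏ i, Sum.elim x (Complex.exp ∘ x) i ^ (v k i)` with `v : Fin (n+1) → (Fin n ⊕ Fin n →
ℤ)` ℤ-linearly independent, so
neither binomial ideals nor subtori need a Lean notion. No cite facts wanted (HL, LW, GS, Baker, six
exponentials are tree theorems).

Novelty: Searches (2026-08-15, this session): `lit search --hybrid "Schanuel conjecture subtorus coset
multiplicative relations exponential
point binomial"` (12 docs, vector leg only — FTS leg busy; Pila2022 pp. 6, 11, 124–125 read); `lit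
vsearch` "Schanuel restricted to
monomial varieties / Laurent monomials in z, e^z algebraic / translate of a subtorus containing (z,
e^z)" (10 docs: Pila2022 p. 125,
Chudnovsky1984 pp. 177–178 colored sequences — unrelated); `lit galaxy search --star all`
"counterexample to Schanuel's conjecture"
(1 row, irrelevant) and "Schanuel's conjecture implies" (7 rows: Murty–Rath 2014 Transcendental
Numbers, Steuding Diophantine
Analysis, Lang Collected Papers II, Zhu Yaochen; two theses); negatives index (0 refuted
statements); decl lists of all 15 open
Schanuel routes (no toric/monomial item; RigidCore.SparsityTwo is geometric finiteness on ℚ-curves).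
Gen-1 session (same card):
`lit frontier Schanuel --since 2020` (30 rows; nearest doi:10.1112/jlms.70536 / arXiv:2504.10611,
CIT in tori, multiplicative side
only), `lit bridges Schanuel --cross any` (30, none toric-on-the-additive-side), `lit galaxy search
"Schanuel's conjecture" --star all`
(40 rows: Pila2022, Murty–Rath, D'Aquino–Macintyre–Terzo, DaquinoFornasieroTerzo2017 =
doi:10.1090/tran/7206). Card audit
(refuter-triage 2026-08-15): Eisenbud–Sturmfels + coordinatewise Log not in print or pool; graded
new-combination.
Nearest prior art found: Zilber2002 (doi:10.1112/s0024610701002861) and KirbyZilber201  [refs: 10.1112/jlms.70536, 10.1090/tran/7206, 10.1112/s0024610701002861, 2504.10611, doi:10.1112/jlms.70536, doi:10.1090/tran/7206, doi:10.1112/s0024610701002861, Pila2022, Chudnovsky1984, DaquinoFornasieroTerzo2017, Zilber2002, KirbyZilber2014, EisenbudSturmfels1996, Roy1995, Waldschmidt2005]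

Barriers (technique_class: toric-intersections, linear-forms-in-logarithms, census): - technique_class: toric-intersections, linear-forms-in-logarithms, census
- Literature.Barriers.Schanuel.AlgebraicIndependenceOfLogarithms: APPLIES to TwoLogMonomialAtom and
to the r = 0 face of SelfLogMonomialAtom (2-log algebraic independence is beyond every
linear-independence method); not evaded — the route ISOLATES this face as an atom and proves
everything around it with Hermite–Lindemann/Baker, which lie inside the barrier's proved (linear)
region; the bet for the atom itself is external (holonomy / E⊗G engines of other cards), named, not
supplied.
- Literature.Barriers.Schanuel.LinearSubgroupMethodLimit: APPLIES to the quadratic instances ℓ₁² ∈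
ℚ̄·ℓ₂ (e^{π²}, 2^{log 2}) of TwoLogMonomialAtom — Roy's no-go (roy1995_thm_3_4) says the linear
subgroup method cannot reach points on an irreducible quadric; it does not evade it; the bet is only
that monomial (rank-one, "fewnomial") relations are the most structured quadratic relations, the one
region where partial results exist at all (Waldschmidt2005 Thm 2.11, Cor. 2.12–2.14), and the atom
is filed as a target for other engines, not claimed.
- Literature.Barriers.Schanuel.EFunctionValuesAtAlgebraicPoints: APPLIES to TowerAtom (e^{c·e^β} is
not the value of an E-function at an algebraic point, cf. tree ExpExpNotEValue); Siegel–Shidlovskii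
alone cannot prove it; not evaded — TowerAtom is filed as the clean target for mixed E/log engines
(cards tensor-mixed-gevrey-division, shift-difference-periods).
- Literature.Barriers.Sch

History (route lifecycle, newest last):
- 2026-08-15T19:11:14Z · rev 1: restated FirstFailureIsToric (stmt-Schanuel-12031) — cone repair (rrepair-Schanuel-ToricSector-08d93d25): restate FirstFailureIsToric 1:1 with `SchanuelRank r` unfolded (definitionally the same Prop — Iff.rfl chec (planner-rrepair-Schanuel-ToricSector-08d93d25-0)
- 2026-08-16T02:19:05Z · AUTO-CRUX: 1 conjecture-grade item(s) promoted to crux (TwoLogMonomialAtom) — refuter vetting / tiering apply (operator:999:1362873)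
- 2026-08-23T13:36:23Z · DORMANT — reconciler: no traction for 6.1 d (last activity item-evidence-added at 2026-08-17T10:59:37Z); parked, not closed — `ledger route dormant route-Schanuel-ToricSe (operator:999:2230135)

sub-problem: Schanuel · status: dormant · opened planner-plancard-Schanuel-Schanuel-toric-spar-fd09ac9e-g2-0 2026-08-15T18:48:01Z · rev 4 · ledger route-Schanuel-ToricSector
GENERATED by the gate from the ledger (D-0016/17). Provers cite these decls: `theorem foo : Summit.Schanuel.Schanuel.Theses.ToricSector.<Decl> := …` in Summits/Schanuel/Schanuel/Theorems/<Name>.lean.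
-/

namespace Summit.Schanuel.Schanuel.Theses.ToricSector

open scoped BigOperators Topology Manifold Classical MeasureTheory ProbabilityTheory Matrix InnerProductSpace ComplexConjugate ContinuousMap
open Filter Set Function TopologicalSpace MeasureTheory

attribute [summit_statement] _root_.Schanuel

open Literature.Periods

/-- item stmt-Schanuel-12027 · crux · rank 2 · open · by planner
why it might fail: a configuration lost in the WLOG rescalings (roots of unity in cᵢ, t ↦ t/d, saturation of Λ vs Λ⊗ℚ, the branch of Log w) would be a third atom shape and refute the ↔ as stated (then restate with that atom added).
sources: EisenbudSturmfels1996, Lindemann1882, BakerTNT1975, Zilber2002, Pila2022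
[crux] TORIC CENSUS, n = 2 (card T2, sharpened to an equivalence; both sides INLINED because the
gate renders rank 2 first — definitionally `level-2 ToricSchanuel ↔ (TowerAtom ∧
SelfLogMonomialAtom)`): for ℚ-independent pairs, "among any three ℤ-independent Laurent monomials in
(x₁, x₂, e^{x₁}, e^{x₂}) one is transcendental" holds iff both atoms hold. Proof plan (provable
now): MonomialNormalFormTwo, then sort (m₁, m₂): (0, 0) contradicts Hermite–Lindemann (𝓛 ∩ ℚ̄ =
{0}); exactly one mᵢ = 0 rescales to a TowerAtom failure and back (w = e^{(β−ℓ)/r}, x = (β,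
c·e^{β′}); conversely x = (β, c·e^β) carries X₁, X₂Y₁⁻¹, Y₂ᵗY₁⁻ˢ ∈ ℚ̄); m₁m₂ ≠ 0 is verbatim Ω.
STAFF IT FIRST: it is the item saying the sector has exactly these two atoms and no third. [deps:
TowerAtom, SelfLogMonomialAtom, MonomialNormalFormTwo] [difficulty: M] -/
@[route_item "route-Schanuel-ToricSector"]
def ToricCensusTwo : Prop :=
  (∀ (x : Fin 2 → ℂ), LinearIndependent ℚ x → ∀ v : Fin 3 → (Fin 2 ⊕ Fin 2 → ℤ), LinearIndependent ℤ v → ∃ k, Transcendental ℚ (∏ i, Sum.elim x (Complex.exp ∘ x) i ^ (v k i))) ↔ ((∀ (β c : ℂ) (q : ℚ), IsAlgebraic ℚ β → β ≠ 0 → IsAlgebraic ℚ c → c ≠ 0 → ¬ IsAlgebraic ℚ (Complex.exp (c * Complex.exp β - (q : ℂ) * β))) ∧ (∀ (w : ℂ) (β : Fin 2 → ℂ) (m : Fin 2 → ℤ) (r : Fin 2 → ℚ), w ≠ 0 → (∀ i, IsAlgebraic ℚ (β i) ∧ β i ≠ 0 ∧ m i ≠ 0) → LinearIndependent ℚ (fun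 i => β i * w ^ (m i)) → ∃ i, ¬ IsAlgebraic ℚ (Complex.exp (β i * w ^ (m i) - (r i : ℂ) * Complex.log w))))

/-- item stmt-Schanuel-12028 · crux · rank 3 · open · by planner
why it might fail: its r = 0 face is 2-log algebraic independence (e^{π²}, 2^{log 2}, π·log 2 ∉ ℚ̄): beyond Baker and provably beyond the linear subgroup method (Roy1995 Thm 3.4, tree LinearSubgroupMethodLimit); for r ≠ 0 no tool sees Log w of a transcendental w.
sources: Waldschmidt2005Periodes, Waldschmidt2005, Roy1995, Pila2022, DaquinoFornasieroTerzo2017, MarquesSondow2010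
[crux] SELF-LOGARITHMIC MONOMIAL ATOM Ω (card atoms β, γ and the two-variable branch, unified): for
w ≠ 0, algebraic β₁, β₂ ≠ 0, non-zero integers m₁, m₂ and rationals r₁, r₂ with β₁w^{m₁}, β₂w^{m₂}
ℚ-linearly independent, NOT both βᵢw^{mᵢ} − rᵢ·Log w are logarithms of algebraic numbers
(equivalently e^{βᵢw^{mᵢ}} ∈ ℚ̄·w^{rᵢ} cannot hold twice). Faces: r = (0,0) = TwoLogMonomialAtom
(support; its sub-face p + q = 0 known, LogRatioKnown); one rᵢ = 0: Lambert/Ω-type e^{βwᵐ} ∈ ℚ̄·wʳ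
for w a radical of a logarithm; r₁r₂ ≠ 0, m₁ ≠ m₂: w a root of the trinomial β₁W^{m₁}/r₁ −
β₂W^{m₂}/r₂ = ℓ ∈ 𝓛 with e^{β₁w^{m₁}/r₁} ∈ ℚ̄·w. A consequence of Schanuel (x = (β₁w^{m₁}, β₂w^{m₂})
would be toric-bad). [difficulty: open-problem] -/
@[route_item "route-Schanuel-ToricSector"]
def SelfLogMonomialAtom : Prop :=
  ∀ (w : ℂ) (β : Fin 2 → ℂ) (m : Fin 2 → ℤ) (r : Fin 2 → ℚ), w ≠ 0 → (∀ i, IsAlgebraic ℚ (β i) ∧ β i ≠ 0 ∧ m i ≠ 0) → LinearIndependent ℚ (fun i => β i * w ^ (m i)) → ∃ i, ¬ IsAlgebraic ℚ (Complex.exp (β i * w ^ (m i) - (r i : ℂ) * Complex.log w))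

/-- item stmt-Schanuel-12029 · crux · rank 4 · open · by planner
why it might fail: contains e^e ∉ ℚ̄ and eπ ∉ ℚ̄ (open; Rivoal2024 §4 p. 204, BakerTNT1975 Ch. 12); e^{c·e^z} is not an E-function, so Siegel–Shidlovskii is blind and no auxiliary function adapted to both storeys is known.
sources: Rivoal2024, BakerTNT1975, Lindemann1882, Lang1966, Waldschmidt2004
[crux] TOWER ATOM (second-storey Hermite–Lindemann; the exact toric form of card atom α): for
algebraic β ≠ 0, algebraic c ≠ 0 and rational q, c·e^β − qβ is not the logarithm of an algebraic
number, i.e. e^{c·e^β} ∉ ℚ̄·e^{qβ}. Instances: e^e ∉ ℚ̄ (β = c = 1, q = 0), e^e ∉ ℚ̄·e^ℚ, eπ ∉ ℚ̄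
and π/e ∉ ℚ̄ (β = ∓1, q = 0, iπ ∈ 𝓛), e ∉ ℚ + 𝓛. A consequence of Schanuel (x = (β, c·e^β): trdeg
ℚ(e^β, e^{ce^β}) = 2). [difficulty: open-problem] -/
@[route_item "route-Schanuel-ToricSector"]
def TowerAtom : Prop :=
  ∀ (β c : ℂ) (q : ℚ), IsAlgebraic ℚ β → β ≠ 0 → IsAlgebraic ℚ c → c ≠ 0 → ¬ IsAlgebraic ℚ (Complex.exp (c * Complex.exp β - (q : ℂ) * β))

/-- item stmt-Schanuel-12030 · crux · rank 5 · open · by planner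
why it might fail: level 2 already contains e^e, eπ, e^{π²}, 2^{log 2} ∉ ℚ̄ and level 4 the four exponentials conjecture; beyond n = 2 the level census may not close into finitely many atom TYPES; false iff one binomial Schanuel counterexample exists (which refutes SC itself).
sources: Lang1966, Pila2022, Waldschmidt2005, Waldschmidt2005Periodes, EisenbudSturmfels1996, Zilber2002
[crux] TORIC SCHANUEL, all levels (the SECTOR X₁; card "Toric-SC(n) for all n"): for every n and
every ℚ-linearly independent x ∈ ℂⁿ, among any n + 1 ℤ-linearly independent Laurent monomials in
(x₁,…,xₙ, e^{x₁},…,e^{xₙ}) at least one is transcendental — the point (x, eˣ) lies on no algebraic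
translate of a subtorus of 𝔾ₘ^{2n} of dimension ≤ n − 1. Level 1 = Hermite–Lindemann (support
LevelOneIsHermiteLindemann); level 2 ⟺ TowerAtom ∧ SelfLogMonomialAtom (ToricCensusTwo); level 4
contains the four exponentials conjecture (x = (x₁y₁, x₁y₂, x₂y₁, x₂y₂) ∈ 𝓛⁴ carries X₁X₄ = X₂X₃; a
prover may attach `ToricSchanuel →
Literature.NumberTheory.Transcendental.FourExponentialsConjecture` with --supports). Schanuel ⟹ it
(support SchanuelImpliesToric). [difficulty: open-problem] -/
@[route_item "route-Schanuel-ToricSector", crux]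
def ToricSchanuel : Prop :=
  ∀ (n : ℕ) (x : Fin n → ℂ), LinearIndependent ℚ x → ∀ v : Fin (n + 1) → (Fin n ⊕ Fin n → ℤ), LinearIndependent ℤ v → ∃ k, Transcendental ℚ (∏ i, Sum.elim x (Complex.exp ∘ x) i ^ (v k i))

-- earlier FirstFailureIsToric (stmt-Schanuel-12031, replaced 2026-08-15T19:11:14Z -> stmt-Schanuel-14712): retired by None — ∀ (n : ℕ), (∀ r < n, Literature.NumberTheory.Transcendental.SchanuelRank r) → ∀ (x : Fin n → ℂ), LinearIndependent ℚ x → Algebra.trdeg ℚ ↥(IntermediateField.adjoin ℚ (Set.range x ∪ Set.range (Complex.exp ∘ x))) < (n : Cardinal) → ∃ v : Fin (n + 1) → (Fin n ⊕ Fin n → ℤ), Linear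
/-- item stmt-Schanuel-14712 · crux · rank 6 · open · by planner
why it might fail: it is most of Schanuel: at n = 2 it says P(e, π) = 0 forces an algebraic monomial eᵃπᵇiᶜ; no descent is known (dividing out a relation y^b = γ lands on "ℓ ∈ 𝓛 algebraic over ℚ(x′, e^{x′})", i.e. e ⊥ π again); no engine is claimed — SC ⟹ it vacuously.
sources: Kirby2010EAEF, Pila2022, Lang1966, BaysKirby2018ANT, Ax1971
[crux] THE COMPLEMENT X₂ ("Schanuel off the toric sector", weakest closing form): if Schanuel holds
at every rank r < n (the rank-r statement is written INLINE — verbatim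
`Literature.NumberTheory.Transcendental.SchanuelRank r` of Roy2001 Conj. 1 by `Iff.rfl`; inlined at
the 2026-08-15 cone repair so that the route file imports nothing beyond the Statement) and x ∈ ℂⁿ
is ℚ-linearly independent with trdeg ℚ(x, eˣ) < n, then x is toric-bad — (x, eˣ) satisfies n + 1
ℤ-independent algebraic Laurent-monomial relations. Vacuous under Schanuel; at a first failure trdeg
= n − 1 exactly and every coordinate pair (xᵢ, e^{xᵢ}) is algebraic over the others; trivially true
when trdeg = 0. Structural claim about minimal counterexamples, parallel to (and combinable with)
Kirby2010EAEF Prop. 7.2 (essential counterexamples lie in ecl(∅), tree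
`schanuelConjecture_iff_ecl_empty_holds`) and route-Schanuel-RigidCore's MinimalCounterexampleInAcl.
Its functional analogue is TRUE and is Ax's theorem (a functional deficit comes from a ℚ-linear
dependence of exponents mod ℂ, i.e. a Y-monomial relation) — which is exactly why Ax gives nothing
here (barrier AxSchanuelFunctionalNotNumerical). [difficulty: open- -/
@[route_item "route-Schanuel-ToricSector", crux]
def FirstFailureIsToric : Prop :=
  ∀ (n : ℕ), (∀ r < n, ∀ (z : Fin r → ℂ), LinearIndependent ℚ z → (r : Cardinal) ≤ Algebra.trdeg ℚ ↥(IntermediateField.adjoin ℚ (Set.range z ∪ Set.range (Complex.exp ∘ z)))) → ∀ (x : Fin n → ℂ), LinearIndependent ℚ x → Algebra.trdeg ℚ ↥(IntermediateField.adjoin ℚ (Set.range x ∪ Set.range (Complex.exp ∘ x))) < (n : Cardinal) → ∃ v : Fin (n + 1) → (Fin n ⊕ Fin n → ℤ), LinearIndependent ℤ v ∧ ∀ k, IsAlgebraic ℚ (∏ i, Sum.elim x (Complex.exp ∘ x) i ^ (v k i))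

/-- item stmt-Schanuel-12032 · crux (kind.auto-crux: conjecture-grade) · rank 9 · open · by planner
why it might fail: auto-crux — conjecture-grade statement (docstring avows it ('Open problem')); it is open, so it may simply be false
sources: Waldschmidt2005Periodes, Waldschmidt2005, Pila2022, Roy1995, Roy1992, BakerTNT1975
[support] TWO-LOG MONOMIAL ATOM (rung = pure-log face r = 0 of Ω; Waldschmidt's three-logarithm /
four-exponentials family, monomial case; implied by LogPatterns.LogSector = AlgIndepLogarithms, so a
prover may attach `LogSector → TwoLogMonomialAtom`): for ℚ-linearly independent logarithms of
algebraic numbers ℓ₁, ℓ₂ and integers (p, q) ≠ (0, 0), ℓ₁^p·ℓ₂^q is transcendental. Contains e^{π²}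
∉ ℚ̄ ((iπ)²·(π²)⁻¹ = −1), 2^{log 2} ∉ ℚ̄, (log 2)(log 3) ∉ ℚ̄, π·log 2 ∉ ℚ̄; the face p + q = 0 is
KNOWN (LogRatioKnown). Open problem; filed as support (a face of crux 3, reached through
TwoLogIffPureSelfLog). [difficulty: open-problem] -/
@[route_item "route-Schanuel-ToricSector"]
def TwoLogMonomialAtom : Prop :=
  ∀ (l₁ l₂ : ℂ) (p q : ℤ), IsAlgebraic ℚ (Complex.exp l₁) → IsAlgebraic ℚ (Complex.exp l₂) → LinearIndependent ℚ ![l₁, l₂] → ¬ (p = 0 ∧ q = 0) → Transcendental ℚ (l₁ ^ p * l₂ ^ q)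

/-- item stmt-Schanuel-12033 · support · rank 9 · open · by planner
sources: EisenbudSturmfels1996, Zilber2002, BakerTNT1975
[support] MONOMIAL NORMAL FORM, all n (card T1 = the log-linearisation dictionary, multiplicative
form; level n = k + 1): ToricSchanuel ⟺ for every w ∈ (ℂˣ)ᵏ, any k + 1 ℚ-linearly independent
algebraic Laurent monomials cᵢ·w^{mᵢ} do not all lie in ℚ·Log w₁ + … + ℚ·Log w_k + 𝓛 ("the algebraic
monomials of w inside ℚ⟨Log w⟩ + 𝓛 span ≤ k dimensions"; k = 0 is Hermite–Lindemann). ⇒: Log xᵢ =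
log cᵢ + Σ mᵢⱼ Log wⱼ mod 2πiℤ ⊂ 𝓛, so all of x, Log x lie in ℚ⟨Log w⟩ + 𝓛 and rank Λ_x = 2n −
dim(ℚ⟨x, Log x⟩ + 𝓛)/𝓛 ≥ n + 1. ⇐: rank Λ_x ≥ n + 1 puts x, Log x in span(t₁..t_k) + 𝓛; write Log xᵢ
= Σ (mᵢⱼ/d)tⱼ + ℓᵢ, wⱼ = e^{tⱼ/d}, cᵢ = e^{ℓᵢ}. Pure algebra: 𝓛 is a ℚ-subspace, x^a = e^{a·Log x}
for a ∈ ℤ. [difficulty: provable-now] -/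
@[route_item "route-Schanuel-ToricSector"]
def MonomialNormalForm : Prop :=
  ToricSchanuel ↔ ∀ (k : ℕ) (w : Fin k → ℂ) (c : Fin (k + 1) → ℂ) (m : Fin (k + 1) → Fin k → ℤ) (r : Fin (k + 1) → Fin k → ℚ), (∀ j, w j ≠ 0) → (∀ i, IsAlgebraic ℚ (c i) ∧ c i ≠ 0) → LinearIndependent ℚ (fun i => c i * ∏ j, w j ^ (m i j)) → ∃ i, ¬ IsAlgebraic ℚ (Complex.exp (c i * ∏ j, w j ^ (m i j) - ∑ j, (r i j : ℂ) * Complex.log (w j)))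

/-- item stmt-Schanuel-12034 · support · rank 9 · open · by planner
sources: EisenbudSturmfels1996, BakerTNT1975
[support] MONOMIAL NORMAL FORM, n = 2 (the case the census uses; left side = level-2 ToricSchanuel
inlined): for every w ≠ 0, two ℚ-linearly independent algebraic Laurent monomials c₁w^{m₁}, c₂w^{m₂}
(mᵢ ∈ ℤ, possibly 0) never both lie in ℚ·Log w + 𝓛. [difficulty: provable-now] -/
@[route_item "route-Schanuel-ToricSector"]
def MonomialNormalFormTwo : Prop :=
  (∀ (x : Fin 2 → ℂ), LinearIndependent ℚ x → ∀ v : Fin 3 → (Fin 2 ⊕ Fin 2 → ℤ), LinearIndependent ℤ v → ∃ k, Transcendental ℚ (∏ i, Sum.elim x (Complex.exp ∘ x) i ^ (v k i))) ↔ ∀ (w : ℂ) (c : Fin 2 → ℂ) (m : Fin 2 → ℤ) (r : Fin 2 → ℚ), w ≠ 0 → (∀ i, IsAlgebraic ℚ (c i) ∧ c i ≠ 0) → LinearIndependent ℚ (fun i => c i * w ^ (m i)) → ∃ i, ¬ IsAlgebraic ℚ (Complex.exp (c i * w ^ (m i) - (r i : ℂ) * Complex.log w))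

/-- item stmt-Schanuel-12035 · support · rank 9 · open · by planner
sources: Lindemann1882, BakerTNT1975
[support] LEVEL 1 of the sector is Hermite–Lindemann (unit test of the monomial dictionary, provable
now from tree `transcendental_exp_holds`): for x ≠ 0, among any two ℤ-independent monomials
x^{a₁}e^{b₁x}, x^{a₂}e^{b₂x} one is transcendental (if both were algebraic, x^{det} and e^{det·x}
would be algebraic with det ≠ 0, so x ∈ ℚ̄ˣ and e^{det·x} ∈ ℚ̄, contradicting HL). [difficulty:
provable-now] -/
@[route_item "route-Schanuel-ToricSector"]
def LevelOneIsHermiteLindemann : Prop :=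
  ∀ (x : Fin 1 → ℂ), LinearIndependent ℚ x → ∀ v : Fin 2 → (Fin 1 ⊕ Fin 1 → ℤ), LinearIndependent ℤ v → ∃ k, Transcendental ℚ (∏ i, Sum.elim x (Complex.exp ∘ x) i ^ (v k i))

/-- item stmt-Schanuel-12036 · support · rank 9 · open · by planner
sources: BakerTNT1975, Lindemann1882
[support] the two-log atom IS the pure-log face (r = 0) of Ω: TwoLogMonomialAtom ⟺ for w ≠ 0 two
ℚ-independent algebraic monomials β₁w^{m₁}, β₂w^{m₂} (mᵢ ≠ 0) are not both in 𝓛. (⇒: ℓᵢ = βᵢw^{mᵢ}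
gives ℓ₁^{m₂}ℓ₂^{−m₁} ∈ ℚ̄. ⇐: for ℓ₁^pℓ₂^q = γ reduce to p, q coprime, take a, b with bp − aq = 1,
w = ℓ₁^aℓ₂^b; {(a,b),(p,q)} is a basis of ℤ², so ℓᵢ = w^{mᵢ}γ′^{sᵢ} with mᵢ = ±q, ±p ≠ 0; the case
pq = 0 is Hermite–Lindemann directly.) [difficulty: provable-now] -/
@[route_item "route-Schanuel-ToricSector"]
def TwoLogIffPureSelfLog : Prop :=
  TwoLogMonomialAtom ↔ ∀ (w : ℂ) (β : Fin 2 → ℂ) (m : Fin 2 → ℤ), w ≠ 0 → (∀ i, IsAlgebraic ℚ (β i) ∧ β i ≠ 0 ∧ m i ≠ 0) → LinearIndependent ℚ (fun i => β i * w ^ (m i)) → ∃ i, ¬ IsAlgebraic ℚ (Complex.exp (β i * w ^ (m i)))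

/-- item stmt-Schanuel-12037 · support · rank 9 · open · by planner
sources: Gelfond1934, BakerTNT1975
[support] the KNOWN face p + q = 0 of the two-log atom: for ℚ-independent ℓ₁, ℓ₂ ∈ 𝓛 and p ≠ 0,
(ℓ₁/ℓ₂)^p is transcendental (else ℓ₁ = bℓ₂ with b ∈ ℚ̄ ∖ ℚ, a vanishing ℚ̄-linear form in two
ℚ-independent logarithms, contradicting Baker, tree
`Literature.NumberTheory.Transcendental.baker_holds`; or Gelfond–Schneider,
`gelfond_schneider_holds`). [difficulty: provable-now] -/
@[route_item "route-Schanuel-ToricSector"]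
def LogRatioKnown : Prop :=
  ∀ (l₁ l₂ : ℂ) (p : ℤ), IsAlgebraic ℚ (Complex.exp l₁) → IsAlgebraic ℚ (Complex.exp l₂) → LinearIndependent ℚ ![l₁, l₂] → p ≠ 0 → Transcendental ℚ (l₁ ^ p * l₂ ^ (-p))

/-- item stmt-Schanuel-12038 · support · rank 9 · open · by planner
sources: Lang1966, Pila2022
[support] the sector lies below the summit: Schanuel ⟹ ToricSchanuel (n + 1 independent algebraic
monomial values put p = (x, eˣ) on a ℚ̄-variety of dimension ≤ n − 1, so trdeg ℚ(x, eˣ) ≤ n − 1; in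
Lean: complete the n + 1 exponent vectors by n − 1 coordinate monomials to a ℚ-basis, every
coordinate is algebraic over the field generated by those n − 1 values and ℚ̄, `Algebra.trdeg`
monotonicity / `IsTranscendenceBasis` cardinality). [difficulty: L] -/
@[route_item "route-Schanuel-ToricSector"]
def SchanuelImpliesToric : Prop :=
  Schanuel → ToricSchanuel

/-- item stmt-Schanuel-12039 · support · rank 9 · open · by planner
sources: Lang1966, Kirby2010EAEF
[support] the toric split is EXACT: Schanuel ⟺ ToricSchanuel ∧ FirstFailureIsToric (→:
SchanuelImpliesToric and vacuity of the complement's hypothesis trdeg < n; ←: the deciding theorem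
`closes`, strong induction on n). Records that the route neither weakens nor strengthens the summit.
[difficulty: L] -/
@[route_item "route-Schanuel-ToricSector"]
def ToricSplitExact : Prop :=
  Schanuel ↔ (ToricSchanuel ∧ FirstFailureIsToric)

/-- item stmt-Schanuel-12040 · assembly · rank 1 · open · by planner
sources: Lang1966, Kirby2010EAEF, EisenbudSturmfels1996
[assembly] ToricSchanuel → FirstFailureIsToric → Schanuel (strong induction on the rank; the
deciding theorem `closes` is this term). -/
@[route_item "route-Schanuel-ToricSector"]
def Assembly : Prop :=
  ToricSchanuel → FirstFailureIsToric → Schanuel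

/-! D-0027 §2.1 — DECIDING THEOREM (planner-authored via `route open/edit --closes-file`; by planner-plancard-Schanuel-Schanuel-toric-spar-fd09ac9e-g2-0 2026-08-15T18:48:02Z):
its hypotheses are this route's items and its conclusion the sub-problem Statement (glue_lint), and it elaborates with this file. -/

/-- D-0027 §2.1 deciding theorem of route ToricSector: the toric sector `ToricSchanuel` (no ℚ-linearly
independent x puts (x, eˣ) on an algebraic translate of a subtorus of 𝔾ₘ^{2n} of dimension ≤ n − 1) and its
exact complement `FirstFailureIsToric` (a first-failure counterexample to Schanuel IS on such a translate)
decide `Schanuel` by strong induction on the rank n: at a first failure (all `SchanuelRank r`, r < n, by the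
induction hypothesis; x independent with trdeg < n) the complement produces n + 1 ℤ-independent algebraic
Laurent monomials in (x, eˣ) and the sector says one of them is transcendental. Pure logic over the two cruxes. -/
@[closes "route-Schanuel-ToricSector"] theorem closes (hT : ToricSchanuel) (hF : FirstFailureIsToric) : _root_.Schanuel := by
  show ∀ (n : ℕ) (z : Fin n → ℂ), LinearIndependent ℚ z →
    (n : Cardinal) ≤ Algebra.trdeg ℚ
      ↥(IntermediateField.adjoin ℚ (Set.range z ∪ Set.range (Complex.exp ∘ z)))
  intro n
  induction n using Nat.strong_induction_on with
  | _ n ih =>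
    intro z hz
    by_contra hlt
    obtain ⟨v, hv, halg⟩ := hF n (fun r hr => ih r hr) z hz (lt_of_not_ge hlt)
    obtain ⟨k, hk⟩ := hT n z hz v hv
    exact hk (halg k)

end Summit.Schanuel.Schanuel.Theses.ToricSector
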